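import Summits.CriticalPhenomena.Ising3DConformalLimit.Theorems.SynchronousCouplingRotationJoiningMomentsToTestsTools
import HarnessLib

/-!
# Method of moments, difference form (`stub_momentsToTests` = `MomentsToTests`)
(route `SynchronousCoupling`, crux `RotationJoining`, stmt-CriticalPhenomena-18763, line `SketchIdeator2`, reshape 2)

Two sequences `X n, Y n : Ω → (Fin j → ℝ)` of bounded random vectors with uniformly sub-Gaussian even coordinate
moments `E[(X n)ᵢ^{2k}] ≤ (Kk)^k` and asymptotically equal mixed moments have asymptotically equal expectations of
every bounded continuous test function. Pure probability, nothing lattice-specific.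

Proof.
* `tendsto_integral_sub_of_isTight_of_charFunDual` (abstract, any separable Banach space): two TIGHT sequences of
  probability measures whose characteristic functions `charFunDual` are asymptotically equal integrate every bounded
  continuous function asymptotically equally. Along any ultrafilter finer than `atTop` both sequences converge
  weakly (PROKHOROV, `isCompact_closure_of_isTightMeasureSet`); weak convergence is tested on the bounded continuous
  functions `v ↦ exp(i L v)` (`probCharDual`), so the two limits have equal characteristic functions and coincide
  (LÉVY uniqueness, `Measure.ext_of_charFunDual`); hence `∫ g` has the same limit along the ultrafilter for both, and
  `Filter.tendsto_iff_ultrafilter` concludes.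
* `isTightMeasureSet_of_sq_moments`: tightness of the laws of `X n` on `Fin j → ℝ` (sup norm) from `E[(X n)ᵢ²] ≤ K`
  (the case `k = 1`), by Chebyshev: `P(‖X n‖ > r) ≤ P(Σᵢ (X n)ᵢ² ≥ r²) ≤ jK/r²`.
* `stub_momentsToTests`: for `L` in the dual, `L v = Σᵢ vᵢ L(δᵢ)`, so `charFunDual (law of X n) L = E exp(i Σᵢ (X n)ᵢ tᵢ)`
  with `tᵢ = L(δᵢ)`, and the registered tool `stub_momentsToCharDiff`
  (`Theorems/SynchronousCouplingRotationJoiningMomentsToTestsTools.lean`: even-order Taylor expansion of the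
  characteristic function with remainder `≤ (Ck)^k/(2k)! → 0` uniformly in `n`) gives asymptotic equality of the
  characteristic functions; transport `∫ f (X n) dP = ∫ f d(law of X n)` (`integral_map`).

References: P. Billingsley, *Convergence of Probability Measures* (2nd ed. 1999), Thm 5.1 (Prokhorov) and
*Probability and Measure* (3rd ed. 1995), Thm 26.3, Thm 29.4, Thm 30.2 (Cramér–Wold, uniqueness and method of
moments). Mathlib: `Prokhorov`, `ProbabilityMeasure.tendsto_iff_forall_integral_tendsto`, `charFunDual`.
No definitions, no named facts, no sorry.
-/

noncomputable section

namespace Summit.CriticalPhenomena.Ising3DConformalLimit.Cruxes.RotationJoining.RateSplitting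

open MeasureTheory Filter Complex Finset BoundedContinuousFunction
open scoped Topology BigOperators Real Nat ENNReal

/-! ### From characteristic functions to bounded continuous tests (tightness, Prokhorov, Lévy) -/

/-- **Tight sequences with asymptotically equal characteristic functions have asymptotically equal
expectations of bounded continuous functions.** Along every ultrafilter both sequences converge weakly
(Prokhorov: the closures of tight sets of probability measures are compact); the two limits have equal
characteristic functions (weak convergence tested on `v ↦ exp (i L v)`), hence coincide
(`Measure.ext_of_charFunDual`); so the integrals of `g` have the same limit along the ultrafilter. -/
theorem tendsto_integral_sub_of_isTight_of_charFunDual {E : Type*} [NormedAddCommGroup E]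
    [NormedSpace ℝ E] [CompleteSpace E] [SecondCountableTopology E] [MeasurableSpace E] [BorelSpace E]
    {μ ν : ℕ → ProbabilityMeasure E}
    (hμ : IsTightMeasureSet {((μ n : ProbabilityMeasure E) : Measure E) | n : ℕ})
    (hν : IsTightMeasureSet {((ν n : ProbabilityMeasure E) : Measure E) | n : ℕ})
    (hchar : ∀ L : StrongDual ℝ E,
      Tendsto (fun n => charFunDual (μ n : Measure E) L - charFunDual (ν n : Measure E) L) atTop (𝓝 0))
    (g : E →ᵇ ℝ) :
    Tendsto (fun n => (∫ x, g x ∂(μ n : Measure E)) - ∫ x, g x ∂(ν n : Measure E)) atTop (𝓝 0) := by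
  rw [Filter.tendsto_iff_ultrafilter]
  intro U hU
  -- weak limits along the ultrafilter
  have hlim : ∀ κ : ℕ → ProbabilityMeasure E,
      IsTightMeasureSet {((κ n : ProbabilityMeasure E) : Measure E) | n : ℕ} →
        ∃ κ' : ProbabilityMeasure E, Tendsto κ (U : Filter ℕ) (𝓝 κ') := by
    intro κ hκ
    have hc : IsCompact (closure (Set.range κ)) :=
      isCompact_closure_of_isTightMeasureSet (by simpa using hκ)
    have hle : (↑(U.map κ) : Filter (ProbabilityMeasure E)) ≤ 𝓟 (closure (Set.range κ)) := by
      rw [Ultrafilter.coe_map, Filter.le_principal_iff, Filter.mem_map]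
      exact Filter.univ_mem' fun n => subset_closure (Set.mem_range_self n)
    obtain ⟨κ', -, hκ'⟩ := hc.ultrafilter_le_nhds (U.map κ) hle
    exact ⟨κ', by rwa [Ultrafilter.coe_map] at hκ'⟩
  obtain ⟨μ', hμ'⟩ := hlim μ hμ
  obtain ⟨ν', hν'⟩ := hlim ν hν
  -- the limits have equal characteristic functions, hence are equal
  have heq : ∀ L : StrongDual ℝ E, charFunDual (μ' : Measure E) L = charFunDual (ν' : Measure E) L := by
    intro L
    have h1 : Tendsto (fun n => charFunDual (μ n : Measure E) L) U (𝓝 (charFunDual (μ' : Measure E) L)) :=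
      (ProbabilityMeasure.tendsto_iff_forall_integral_rclike_tendsto ℂ).1 hμ' (probCharDual L)
    have h2 : Tendsto (fun n => charFunDual (ν n : Measure E) L) U (𝓝 (charFunDual (ν' : Measure E) L)) :=
      (ProbabilityMeasure.tendsto_iff_forall_integral_rclike_tendsto ℂ).1 hν' (probCharDual L)
    exact sub_eq_zero.1 (tendsto_nhds_unique (h1.sub h2) ((hchar L).mono_left hU))
  have hμν : (μ' : Measure E) = ν' := Measure.ext_of_charFunDual (funext heq)
  have hg1 := ProbabilityMeasure.tendsto_iff_forall_integral_tendsto.1 hμ' g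
  have hg2 := ProbabilityMeasure.tendsto_iff_forall_integral_tendsto.1 hν' g
  rw [← hμν] at hg2
  simpa using hg1.sub hg2

/-- **Tightness from bounded second moments**: the laws of random vectors `X n` in `Fin j → ℝ` (sup norm)
with `E[(X n)_i²] ≤ K` form a tight family (Chebyshev: `P(‖X n‖ > r) ≤ P(Σᵢ (X n)ᵢ² ≥ r²) ≤ j K / r²`). -/
theorem isTightMeasureSet_of_sq_moments {Ω : Type*} [MeasurableSpace Ω] (P : Measure Ω)
    [IsProbabilityMeasure P] {j : ℕ} (X : ℕ → Ω → (Fin j → ℝ)) (hX : ∀ n, Measurable (X n))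
    (hbdd : ∀ n, ∃ B : ℝ, ∀ ω i, |X n ω i| ≤ B) {K : ℝ} (hK : ∀ n i, ∫ ω, (X n ω i) ^ 2 ∂P ≤ K) :
    IsTightMeasureSet {x : Measure (Fin j → ℝ) | ∃ n, P.map (X n) = x} := by
  rw [isTightMeasureSet_iff_tendsto_measure_norm_gt]
  have hb : ∀ r : ℝ, 0 < r → ∀ n, P.map (X n) {x | r < ‖x‖} ≤ ENNReal.ofReal (j * K / r ^ 2) := by
    intro r hr n
    obtain ⟨B, hB⟩ := hbdd n
    rw [Measure.map_apply (hX n) (measurableSet_lt measurable_const measurable_norm)]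
    have hsub : X n ⁻¹' {x | r < ‖x‖} ⊆ {ω | r ^ 2 ≤ ∑ i, (X n ω i) ^ 2} := by
      intro ω hω
      simp only [Set.mem_preimage, Set.mem_setOf_eq] at hω ⊢
      by_contra hcon
      refine absurd ((pi_norm_le_iff_of_nonneg hr.le).2 fun i => ?_) (not_le.2 hω)
      rw [Real.norm_eq_abs]
      refine abs_le_of_sq_le_sq ?_ hr.le
      exact le_of_lt ((Finset.single_le_sum (fun i _ => sq_nonneg (X n ω i)) (Finset.mem_univ i)).trans_lt
        (not_le.1 hcon))
    have hint : Integrable (fun ω => ∑ i, (X n ω i) ^ 2) P :=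
      integrable_comp_of_coord_abs_le P (hX n) hB (g := fun v => ∑ i, v i ^ 2) (by fun_prop)
    have hM := mul_meas_ge_le_integral_of_nonneg
      (Eventually.of_forall fun ω => Finset.sum_nonneg fun i _ => sq_nonneg (X n ω i)) hint (r ^ 2)
    have hE : ∫ ω, ∑ i, (X n ω i) ^ 2 ∂P ≤ j * K := by
      rw [integral_finsetSum _ fun i _ => ?_]
      · calc ∑ i, ∫ ω, (X n ω i) ^ 2 ∂P ≤ ∑ _i : Fin j, K := Finset.sum_le_sum fun i _ => hK n i
          _ = j * K := by simp
      · exact integrable_comp_of_coord_abs_le P (hX n) hB (g := fun v => v i ^ 2) (by fun_prop)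
    calc P (X n ⁻¹' {x | r < ‖x‖}) ≤ P {ω | r ^ 2 ≤ ∑ i, (X n ω i) ^ 2} := measure_mono hsub
      _ = ENNReal.ofReal (P.real {ω | r ^ 2 ≤ ∑ i, (X n ω i) ^ 2}) := (ofReal_measureReal (measure_ne_top _ _)).symm
      _ ≤ ENNReal.ofReal (j * K / r ^ 2) := ENNReal.ofReal_le_ofReal ?_
    rw [le_div_iff₀ (by positivity), mul_comm]
    exact hM.trans hE
  have hlim : Tendsto (fun r : ℝ => ENNReal.ofReal (j * K / r ^ 2)) atTop (𝓝 0) := by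
    rw [← ENNReal.ofReal_zero]
    exact ENNReal.tendsto_ofReal (Tendsto.div_atTop tendsto_const_nhds (tendsto_pow_atTop two_ne_zero))
  refine tendsto_of_tendsto_of_tendsto_of_le_of_le' tendsto_const_nhds hlim
    (Eventually.of_forall fun r => zero_le) ?_
  filter_upwards [eventually_gt_atTop 0] with r hr
  refine iSup₂_le fun x hx => ?_
  obtain ⟨n, rfl⟩ := hx
  exact hb r hr n

/-- **`stub_momentsToTests` = `MomentsToTests`** (method of moments, difference form): pass to the laws
`P ∘ (X n)⁻¹`, `P ∘ (Y n)⁻¹` on `Fin j → ℝ`; they are tight (second moments), their characteristic functions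
at `L = Σᵢ tᵢ δᵢ` are asymptotically equal (`stub_momentsToCharDiff`), so bounded continuous tests are
asymptotically equal (`tendsto_integral_sub_of_isTight_of_charFunDual`). -/
theorem stub_momentsToTests : Sig.stub_momentsToTests := by
  intro Ω _ P _ j X Y hX hY hbdd hK hmom f hf hfb
  obtain ⟨K, hK⟩ := hK
  obtain ⟨B, hB⟩ := hfb
  set μ : ℕ → ProbabilityMeasure (Fin j → ℝ) :=
    fun n => ⟨P.map (X n), Measure.isProbabilityMeasure_map (hX n).aemeasurable⟩ with hμ
  set ν : ℕ → ProbabilityMeasure (Fin j → ℝ) :=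
    fun n => ⟨P.map (Y n), Measure.isProbabilityMeasure_map (hY n).aemeasurable⟩ with hν
  set g : (Fin j → ℝ) →ᵇ ℝ := BoundedContinuousFunction.ofNormedAddCommGroup f hf B
    (fun v => by simpa [Real.norm_eq_abs] using hB v) with hg
  have hK1 : ∀ (V : ℕ → Ω → (Fin j → ℝ)), (∀ n i (k : ℕ), ∫ ω, (V n ω i) ^ (2 * k) ∂P ≤ (K * k) ^ k) →
      ∀ n i, ∫ ω, (V n ω i) ^ 2 ∂P ≤ K := fun V hV n i => by simpa using hV n i 1
  have htμ : IsTightMeasureSet {((μ n : ProbabilityMeasure (Fin j → ℝ)) : Measure (Fin j → ℝ)) | n : ℕ} :=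
    isTightMeasureSet_of_sq_moments P X hX (fun n => (hbdd n).imp fun B h ω i => (h ω i).1)
      (hK1 X fun n i k => (hK n i k).1)
  have htν : IsTightMeasureSet {((ν n : ProbabilityMeasure (Fin j → ℝ)) : Measure (Fin j → ℝ)) | n : ℕ} :=
    isTightMeasureSet_of_sq_moments P Y hY (fun n => (hbdd n).imp fun B h ω i => (h ω i).2)
      (hK1 Y fun n i k => (hK n i k).2)
  have hchar : ∀ L : StrongDual ℝ (Fin j → ℝ), Tendsto (fun n => charFunDual (μ n : Measure (Fin j → ℝ)) L
      - charFunDual (ν n : Measure (Fin j → ℝ)) L) atTop (𝓝 0) := by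
    intro L
    set t : Fin j → ℝ := fun i => L (fun j' => if i = j' then 1 else 0) with ht
    have hL : ∀ v : Fin j → ℝ, L v = ∑ i, v i * t i := fun v => by
      simpa [smul_eq_mul] using LinearMap.pi_apply_eq_sum_univ (L : (Fin j → ℝ) →ₗ[ℝ] ℝ) v
    have hcf : ∀ (V : Ω → (Fin j → ℝ)) (hV : Measurable V),
        charFunDual (P.map V) L = ∫ ω, cexp ((∑ i, V ω i * t i : ℝ) * I) ∂P := by
      intro V hV
      rw [charFunDual_apply, integral_map hV.aemeasurable (by fun_prop)]
      simp_rw [hL]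
    simp only [hμ, hν, ProbabilityMeasure.coe_mk, hcf (X _) (hX _), hcf (Y _) (hY _)]
    exact stub_momentsToCharDiff Ω P j X Y hX hY hbdd ⟨K, hK⟩ hmom t
  have key := tendsto_integral_sub_of_isTight_of_charFunDual htμ htν hchar g
  refine key.congr fun n => ?_
  simp only [hμ, hν, ProbabilityMeasure.coe_mk]
  rw [integral_map (hX n).aemeasurable (by fun_prop), integral_map (hY n).aemeasurable (by fun_prop)]
  simp [hg]

end Summit.CriticalPhenomena.Ising3DConformalLimit.Cruxes.RotationJoining.RateSplitting

end
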